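import Mathlib.NumberTheory.SumPrimeReciprocals
import Mathlib.Analysis.Complex.Basic
import Mathlib.Analysis.SpecialFunctions.Pow.Real
import HarnessLib

/-!
# The Kátai–Bourgain–Sarnak–Ziegler criterion, I: the Turán–Kubilius inequality over primes

Topic `Literature/NumberTheory/LFunctions`. Everything in this file is PROVED. It is the first
half of a proof of the qualitative orthogonality criterion of Kátai (I. Kátai, *A remark on a
theorem of H. Daboussi*, Acta Math. Hungar. 47 (1986) 223–225; quantitative form: Bourgain,
Sarnak, Ziegler 2013, Theorem 2) in the form stated and used by J. Konieczny, *Möbius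
orthogonality for q-semimultiplicative sequences*, Monatsh. Math. 192 (2020), **Theorem 2.1**:

> if `f` is bounded and `𝔼_{n<N} f(pn) conj f(p'n) → 0` for every pair of sufficiently large
> distinct primes `p ≠ p'`, then `𝔼_{n<N} f(n) ν(n) → 0` for every bounded multiplicative `ν`.

We follow Kátai's three-page argument (Turán–Kubilius over the primes of a finite set `𝓟`,
then Cauchy–Schwarz in the cofactor `m = n/p`).  This file contains the elementary counting of
multiples and the variance bound

* `Konieczny.turanKubilius_variance` — for a finite set `𝓟` of primes and
  `ω(n) = #{p ∈ 𝓟 : p ∣ n}`, `A = ∑_{p ∈ 𝓟} 1/p`:  `∑_{n<N} (ω(n) - A)² ≤ 2NA + 4(#𝓟)²`,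
* `Konieczny.sum_abs_omega_sub_le` — hence `∑_{n<N} |ω(n) - A| ≤ √(N (2NA + 4 (#𝓟)²))`,

and the second half (`SemimultiplicativeMoebiusKataiCriterion.lean`) the bilinear step and the
limit argument.  All sums are over `Finset.range N` (`n = 0, …, N-1`; `0` counts as a multiple of
everything, which only affects the `+O(1)` terms).
-/

noncomputable section

open Finset

namespace Literature.NumberTheory.LFunctions

namespace Konieczny

/-! ## Counting multiples in `[0, N)` -/

/-- `m < ⌈N/c⌉ ↔ c m < N` with `⌈N/c⌉ = (N + c - 1)/c`. [folklore] -/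
theorem lt_ceilDiv_iff {c : ℕ} (hc : 0 < c) (m N : ℕ) :
    m < (N + c - 1) / c ↔ c * m < N := by
  rw [← Nat.add_one_le_iff, Nat.le_div_iff_mul_le hc, add_mul, one_mul, mul_comm m c]
  generalize c * m = t
  omega

/-- `⌈N/c⌉ ≤ N/c + 1` (real). [folklore] -/
theorem ceilDiv_le_real {c : ℕ} (hc : 0 < c) (N : ℕ) :
    (((N + c - 1) / c : ℕ) : ℝ) ≤ N / c + 1 := by
  have h1 : (N + c - 1) / c ≤ (N + c) / c := Nat.div_le_div_right (Nat.sub_le _ _)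
  rw [Nat.add_div_right N hc] at h1
  calc (((N + c - 1) / c : ℕ) : ℝ) ≤ ((N / c + 1 : ℕ) : ℝ) := by exact_mod_cast h1
    _ = ((N / c : ℕ) : ℝ) + 1 := by push_cast; ring
    _ ≤ N / c + 1 := by gcongr; exact Nat.cast_div_le

/-- `N/c - 1 ≤ ⌈N/c⌉` (real). [folklore] -/
theorem real_le_ceilDiv {c : ℕ} (hc : 0 < c) (N : ℕ) :
    (N : ℝ) / c - 1 ≤ (((N + c - 1) / c : ℕ) : ℝ) := by
  have h1 : N / c ≤ (N + c - 1) / c := Nat.div_le_div_right (by omega)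
  have h2 : (N : ℝ) / c - 1 ≤ ((N / c : ℕ) : ℝ) := by
    have h3 : N < N / c * c + c := Nat.lt_div_mul_add hc
    have hc' : (0 : ℝ) < c := by exact_mod_cast hc
    rw [sub_le_iff_le_add, div_le_iff₀ hc']
    have : (N : ℝ) < (N / c : ℕ) * c + c := by exact_mod_cast h3
    linarith
  exact h2.trans (by exact_mod_cast h1)

/-- The multiples of `d ≥ 1` in `[0, N)` are the `d m`, `m < ⌈N/d⌉`. [folklore] -/
theorem filter_dvd_eq_image {d : ℕ} (hd : 0 < d) (N : ℕ) :
    (range N).filter (d ∣ ·) = (range ((N + d - 1) / d)).image (d * ·) := by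
  ext n
  simp only [mem_filter, mem_range, mem_image]
  constructor
  · rintro ⟨hn, m, rfl⟩
    exact ⟨m, (lt_ceilDiv_iff hd m N).2 hn, rfl⟩
  · rintro ⟨m, hm, rfl⟩
    exact ⟨(lt_ceilDiv_iff hd m N).1 hm, dvd_mul_right d m⟩

/-- `#{n < N : d ∣ n} = ⌈N/d⌉`. [folklore] -/
theorem card_filter_dvd {d : ℕ} (hd : 0 < d) (N : ℕ) :
    #((range N).filter (d ∣ ·)) = (N + d - 1) / d := by
  rw [filter_dvd_eq_image hd, card_image_of_injective _ (mul_right_injective₀ hd.ne'),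
    card_range]

/-- `#{n < N : d ∣ n} ≤ N/d + 1`. [folklore] -/
theorem card_filter_dvd_le {d : ℕ} (hd : 0 < d) (N : ℕ) :
    ((#((range N).filter (d ∣ ·)) : ℕ) : ℝ) ≤ N / d + 1 := by
  rw [card_filter_dvd hd]; exact ceilDiv_le_real hd N

/-- `N/d - 1 ≤ #{n < N : d ∣ n}`. [folklore] -/
theorem le_card_filter_dvd {d : ℕ} (hd : 0 < d) (N : ℕ) :
    (N : ℝ) / d - 1 ≤ ((#((range N).filter (d ∣ ·)) : ℕ) : ℝ) := by
  rw [card_filter_dvd hd]; exact real_le_ceilDiv hd N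

/-- Reindexing a sum over the multiples of `d` in `[0, N)` by the cofactor. [folklore] -/
theorem sum_filter_dvd_eq {M : Type*} [AddCommMonoid M] (G : ℕ → M) {d : ℕ} (hd : 0 < d)
    (N : ℕ) : ∑ n ∈ (range N).filter (d ∣ ·), G n = ∑ m ∈ range ((N + d - 1) / d), G (d * m) := by
  rw [filter_dvd_eq_image hd, sum_image fun a _ b _ h => mul_right_injective₀ hd.ne' h]

/-! ## The Turán–Kubilius variance bound over a finite set of primes -/

/-- `∑_{n<N} [d ∣ n] = #{n < N : d ∣ n}` (real). [folklore] -/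
theorem sum_indicator_dvd_eq_card (d N : ℕ) :
    ∑ n ∈ range N, (if d ∣ n then (1 : ℝ) else 0) = #((range N).filter (d ∣ ·)) := by
  rw [natCast_card_filter]

/-- For distinct primes `p ≠ p'`: `[p ∣ n][p' ∣ n] = [pp' ∣ n]`. [folklore] -/
theorem ite_dvd_mul_ite_dvd {p p' : ℕ} (hp : p.Prime) (hp' : p'.Prime) (hne : p ≠ p') (n : ℕ) :
    (if p ∣ n then (1 : ℝ) else 0) * (if p' ∣ n then (1 : ℝ) else 0) =
      if p * p' ∣ n then (1 : ℝ) else 0 := by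
  have hcop : Nat.Coprime p p' := (Nat.coprime_primes hp hp').2 hne
  by_cases h : p * p' ∣ n
  · rw [if_pos h, if_pos (dvd_trans (dvd_mul_right p p') h),
      if_pos (dvd_trans (dvd_mul_left p' p) h), one_mul]
  · rw [if_neg h]
    by_cases h1 : p ∣ n
    · have h2 : ¬ p' ∣ n := fun h2 => h (hcop.mul_dvd_of_dvd_of_dvd h1 h2)
      rw [if_neg h2, mul_zero]
    · rw [if_neg h1, zero_mul]

/-- Diagonal Turán–Kubilius term: `∑_{n<N} ([p ∣ n] - 1/p)² ≤ 2N/p + 1` (`p ≥ 1`). [folklore] -/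
theorem sum_sq_indicator_sub_le {p : ℕ} (hp : 0 < p) (N : ℕ) :
    ∑ n ∈ range N, ((if p ∣ n then (1 : ℝ) else 0) - 1 / p) ^ 2 ≤ 2 * (N : ℝ) / p + 1 := by
  have hp' : (0 : ℝ) < p := by exact_mod_cast hp
  have hexp : ∀ n : ℕ, ((if p ∣ n then (1 : ℝ) else 0) - 1 / p) ^ 2 ≤
      (if p ∣ n then (1 : ℝ) else 0) + 1 / (p : ℝ) ^ 2 := by
    intro n
    split_ifs
    · have h1 : 0 ≤ 1 / (p : ℝ) := by positivity
      rw [show ((1 : ℝ) - 1 / p) ^ 2 = 1 + 1 / (p : ℝ) ^ 2 - 2 * (1 / p) by ring]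
      linarith
    · exact le_of_eq (by ring)
  calc ∑ n ∈ range N, ((if p ∣ n then (1 : ℝ) else 0) - 1 / p) ^ 2
      ≤ ∑ n ∈ range N, ((if p ∣ n then (1 : ℝ) else 0) + 1 / (p : ℝ) ^ 2) :=
        sum_le_sum fun n _ => hexp n
    _ = #((range N).filter (p ∣ ·)) + N * (1 / (p : ℝ) ^ 2) := by
        rw [sum_add_distrib, sum_indicator_dvd_eq_card, sum_const, card_range, nsmul_eq_mul]
    _ ≤ (N / p + 1) + N / p := by
        refine add_le_add (card_filter_dvd_le hp N) ?_
        rw [mul_one_div, div_le_div_iff₀ (by positivity) hp']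
        have h1 : (1 : ℝ) ≤ p := by exact_mod_cast hp
        have hN : (0 : ℝ) ≤ N := by positivity
        have h2 : (p : ℝ) ≤ (p : ℝ) ^ 2 := by nlinarith
        exact mul_le_mul_of_nonneg_left h2 hN
    _ = 2 * (N : ℝ) / p + 1 := by ring

/-- Off-diagonal Turán–Kubilius term: for distinct primes `p ≠ p'`,
`∑_{n<N} ([p ∣ n] - 1/p)([p' ∣ n] - 1/p') ≤ 3`. [folklore] -/
theorem sum_indicator_sub_mul_le {p p' : ℕ} (hp : p.Prime) (hp' : p'.Prime) (hne : p ≠ p')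
    (N : ℕ) :
    ∑ n ∈ range N, ((if p ∣ n then (1 : ℝ) else 0) - 1 / p) *
        ((if p' ∣ n then (1 : ℝ) else 0) - 1 / p') ≤ 3 := by
  have hp0 : 0 < p := hp.pos
  have hp0' : 0 < p' := hp'.pos
  have hpr : (0 : ℝ) < p := by exact_mod_cast hp0
  have hpr' : (0 : ℝ) < p' := by exact_mod_cast hp0'
  have hexp : ∀ n : ℕ, ((if p ∣ n then (1 : ℝ) else 0) - 1 / p) *
      ((if p' ∣ n then (1 : ℝ) else 0) - 1 / p') =
      (if p * p' ∣ n then (1 : ℝ) else 0) - (1 / p') * (if p ∣ n then (1 : ℝ) else 0) -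
        (1 / p) * (if p' ∣ n then (1 : ℝ) else 0) + 1 / (p * p') := by
    intro n
    rw [← ite_dvd_mul_ite_dvd hp hp' hne n]
    field_simp
    ring
  rw [sum_congr rfl fun n _ => hexp n, sum_add_distrib, sum_sub_distrib, sum_sub_distrib,
    ← mul_sum, ← mul_sum, sum_indicator_dvd_eq_card, sum_indicator_dvd_eq_card,
    sum_indicator_dvd_eq_card, sum_const, card_range, nsmul_eq_mul]
  have h1 := card_filter_dvd_le (Nat.mul_pos hp0 hp0') N
  have h2 := le_card_filter_dvd hp0 N
  have h3 := le_card_filter_dvd hp0' N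
  push_cast at h1
  have i1 : (1 / p' : ℝ) * ((N : ℝ) / p - 1) ≤
      (1 / p' : ℝ) * (#((range N).filter (p ∣ ·)) : ℕ) :=
    mul_le_mul_of_nonneg_left h2 (by positivity)
  have i2 : (1 / p : ℝ) * ((N : ℝ) / p' - 1) ≤
      (1 / p : ℝ) * (#((range N).filter (p' ∣ ·)) : ℕ) :=
    mul_le_mul_of_nonneg_left h3 (by positivity)
  have i3 : (1 / p : ℝ) ≤ 1 := by rw [div_le_one hpr]; exact_mod_cast hp0
  have i4 : (1 / p' : ℝ) ≤ 1 := by rw [div_le_one hpr']; exact_mod_cast hp0'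
  have e1 : (1 / p' : ℝ) * ((N : ℝ) / p - 1) = N / (p * p') - 1 / p' := by
    field_simp
  have e2 : (1 / p : ℝ) * ((N : ℝ) / p' - 1) = N / (p * p') - 1 / p := by
    field_simp
  have i5 : (N : ℝ) * (1 / (p * p')) = N / (p * p') := by ring
  rw [i5]
  linarith

/-- **Turán–Kubilius over a finite set of primes.**  For a finite set `𝓟` of primes, with
`ω(n) = #{p ∈ 𝓟 : p ∣ n}` and `A = ∑_{p∈𝓟} 1/p`:
`∑_{n<N} (ω(n) - A)² ≤ 2 N A + 4 (#𝓟)²`.  This is the variance computation in Kátai's proof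
(Kátai 1986; Konieczny 2020, Theorem 2.1). [cite: Katai1986, proof of the Theorem] -/
theorem turanKubilius_variance (𝓟 : Finset ℕ) (h𝓟 : ∀ p ∈ 𝓟, p.Prime) (N : ℕ) :
    ∑ n ∈ range N, ((#(𝓟.filter (· ∣ n)) : ℝ) - (∑ p ∈ 𝓟, (1 / p : ℝ))) ^ 2 ≤
      2 * N * (∑ p ∈ 𝓟, (1 / p : ℝ)) + 4 * (#𝓟 : ℝ) ^ 2 := by
  -- `ω(n) - A = ∑_p ([p ∣ n] - 1/p)`
  have hω : ∀ n : ℕ, (#(𝓟.filter (· ∣ n)) : ℝ) - (∑ p ∈ 𝓟, (1 / p : ℝ)) =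
      ∑ p ∈ 𝓟, ((if p ∣ n then (1 : ℝ) else 0) - 1 / p) := by
    intro n
    rw [sum_sub_distrib, natCast_card_filter]
  -- expand the square and swap sums
  have hsq : ∀ n : ℕ, (∑ p ∈ 𝓟, ((if p ∣ n then (1 : ℝ) else 0) - 1 / p)) ^ 2 =
      ∑ p ∈ 𝓟, ∑ p' ∈ 𝓟, ((if p ∣ n then (1 : ℝ) else 0) - 1 / p) *
        ((if p' ∣ n then (1 : ℝ) else 0) - 1 / p') := by
    intro n; rw [sq, sum_mul_sum]
  simp_rw [hω, hsq]
  rw [sum_comm]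
  -- bound each pair
  have hpair : ∀ p ∈ 𝓟, ∑ p' ∈ 𝓟, ∑ n ∈ range N, ((if p ∣ n then (1 : ℝ) else 0) - 1 / p) *
      ((if p' ∣ n then (1 : ℝ) else 0) - 1 / p') ≤ (2 * (N : ℝ) / p + 1) + 3 * #𝓟 := by
    intro p hp
    rw [← Finset.add_sum_erase 𝓟 _ hp]
    refine add_le_add ?_ ?_
    · simp_rw [← sq]
      exact sum_sq_indicator_sub_le (h𝓟 p hp).pos N
    · calc ∑ p' ∈ 𝓟.erase p, ∑ n ∈ range N, ((if p ∣ n then (1 : ℝ) else 0) - 1 / p) *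
            ((if p' ∣ n then (1 : ℝ) else 0) - 1 / p')
          ≤ ∑ p' ∈ 𝓟.erase p, (3 : ℝ) := by
            refine sum_le_sum fun p' hp' => ?_
            rw [mem_erase] at hp'
            exact sum_indicator_sub_mul_le (h𝓟 p hp) (h𝓟 p' hp'.2) (Ne.symm hp'.1) N
        _ ≤ 3 * #𝓟 := by
            rw [sum_const, nsmul_eq_mul, mul_comm]
            gcongr
            exact Finset.erase_subset p 𝓟
  calc ∑ p ∈ 𝓟, ∑ n ∈ range N, ∑ p' ∈ 𝓟, ((if p ∣ n then (1 : ℝ) else 0) - 1 / p) *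
          ((if p' ∣ n then (1 : ℝ) else 0) - 1 / p')
      ≤ ∑ p ∈ 𝓟, ((2 * (N : ℝ) / p + 1) + 3 * #𝓟) := by
        refine sum_le_sum fun p hp => ?_
        rw [sum_comm]
        exact hpair p hp
    _ = 2 * N * (∑ p ∈ 𝓟, (1 / p : ℝ)) + #𝓟 + 3 * (#𝓟 : ℝ) ^ 2 := by
        rw [sum_add_distrib, sum_add_distrib, sum_const, sum_const, nsmul_eq_mul, nsmul_eq_mul,
          mul_sum]
        have : ∀ p ∈ 𝓟, (2 * (N : ℝ) / p) = 2 * N * (1 / p) := fun p _ => by ring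
        rw [sum_congr rfl this]
        ring
    _ ≤ 2 * N * (∑ p ∈ 𝓟, (1 / p : ℝ)) + 4 * (#𝓟 : ℝ) ^ 2 := by
        have h1 : (#𝓟 : ℝ) ≤ (#𝓟 : ℝ) ^ 2 := by
          rcases Nat.eq_zero_or_pos #𝓟 with h | h
          · simp [h]
          · have : (1 : ℝ) ≤ #𝓟 := by exact_mod_cast h
            nlinarith
        linarith

/-- **Cauchy–Schwarz form of Turán–Kubilius**: `∑_{n<N} |ω(n) - A| ≤ √(N (2NA + 4(#𝓟)²))`.
[cite: Katai1986, proof of the Theorem] -/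
theorem sum_abs_omega_sub_le (𝓟 : Finset ℕ) (h𝓟 : ∀ p ∈ 𝓟, p.Prime) (N : ℕ) :
    ∑ n ∈ range N, |(#(𝓟.filter (· ∣ n)) : ℝ) - (∑ p ∈ 𝓟, (1 / p : ℝ))| ≤
      Real.sqrt (N * (2 * N * (∑ p ∈ 𝓟, (1 / p : ℝ)) + 4 * (#𝓟 : ℝ) ^ 2)) := by
  set g : ℕ → ℝ := fun n => |(#(𝓟.filter (· ∣ n)) : ℝ) - (∑ p ∈ 𝓟, (1 / p : ℝ))| with hg
  have hCS := sum_mul_sq_le_sq_mul_sq (range N) (fun _ => (1 : ℝ)) g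
  simp only [one_mul, one_pow, sum_const, card_range, nsmul_eq_mul, mul_one] at hCS
  have hV : ∑ n ∈ range N, g n ^ 2 ≤ 2 * N * (∑ p ∈ 𝓟, (1 / p : ℝ)) + 4 * (#𝓟 : ℝ) ^ 2 := by
    simp only [hg, sq_abs]
    exact turanKubilius_variance 𝓟 h𝓟 N
  refine Real.le_sqrt_of_sq_le ?_
  calc (∑ n ∈ range N, g n) ^ 2 ≤ N * ∑ n ∈ range N, g n ^ 2 := hCS
    _ ≤ N * (2 * N * (∑ p ∈ 𝓟, (1 / p : ℝ)) + 4 * (#𝓟 : ℝ) ^ 2) := by gcongr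

end Konieczny

end Literature.NumberTheory.LFunctions
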